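import Summits.AnomalousDissipation.AnomalousDissipation.Theses.MarginalStabilityChain
import Summits.AnomalousDissipation.AnomalousDissipation.Theorems.MarginalStabilityChainChainRealisationStubPhaseMeans
import Summits.AnomalousDissipation.AnomalousDissipation.Theorems.MarginalStabilityChainChainRealisationStubInvariantMeasure
import Summits.AnomalousDissipation.AnomalousDissipation.Theorems.MarginalStabilityChainChainRealisationStubGenericLoudPoint
import Summits.AnomalousDissipation.AnomalousDissipation.Theorems.MarginalStabilityChainChainRealisationStubEternalOrbit
import Summits.AnomalousDissipation.AnomalousDissipation.Theorems.MarginalStabilityChainChainRealisationStubLoudOfContrastZM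
import Summits.AnomalousDissipation.AnomalousDissipation.Theorems.MarginalStabilityChainChainRealisationStubLaplacianSupBound
import Summits.AnomalousDissipation.AnomalousDissipation.Theorems.BaireTransferDenseLoudDesignerForcesErgodicLine
import Literature.Analysis.FunctionSpaces.TorusPlanarLift
import Literature.Analysis.FunctionSpaces.TorusLinearisedFormTruncation
import HarnessLib

/-!
# Eternalisation by generic points, conditional on the forward phase construction
# (line `SketchIdeator2` of the crux `MarginalStabilityChain.ChainRealisation`, stmt-AnomalousDissipation-14249)

Sorry-free CONDITIONAL glue of the line lead's skeleton (`Cruxes/ChainRealisation/Lines/SketchIdeator2.lean`, §2–§4),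
assembled from the landed stubs of the line over the ergodic vocabulary of `Theorems.DenseLoudDesignerForces.Ergodic`
(`Hsp`, `rep`, `energyAvg`, `dissipAvg`, `IsNSPhase`, `IsInvariantMeasure`):

* `eternalisationZM_of_forwardPhase` — IF every forward-regular mean-zero classical Navier–Stokes solution on
  `[0,∞) × T³` at viscosity `ν > 0` lives in an NS phase (hypothesis `hFP`, the statement of the skeleton's open stub
  `stub_forwardPhase`: the fixed-`ν` compact-absorbing-set / parabolic-smoothing construction, Foias–Manley–Rosa–Temam
  2001 Ch. III §2), THEN such a solution with limsup-mean energy `≤ E` and limsup-mean dissipation `≥ ε > 0` yields an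
  ETERNAL classical solution of the same system with dissipation `≥ ε/2` and energy `≤ 16‖f‖₂²·max(E,1)²/ε²`
  (the statement `EternalisationAt` of crux 3005's line `generic-point-eternalisation`, in the mean-zero class).
  Proof: phase trajectory means = Cesàro means (`stub_phaseMeans`); Krylov–Bogoliubov with a generalized limit realising
  the limsup of the dissipation means (`stub_invariantMeasureOfTrajectory`); Birkhoff + trajectory-wise power budget +
  budget selection + support on `⋂ₙ φₙ(K)` give a generic loud point with a complete backward chain
  (`stub_genericLoudPoint`); uniqueness gluing along the chain gives the eternal classical solution (`stub_eternalOrbit`).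
* `chainThesis_of_forwardPhase` — hence a forward-regular loud bounded mean-zero family for ONE smooth solenoidal
  mean-zero force gives `ChainThesis` (crux 3005), conditionally on `hFP`.
* `forwardPhase_of_forwardPhaseH2` — the `H²` rung is DISCHARGED: by the landed absorbing bound `stub_laplacianSupBound`
  (enstrophy bounded ⇒ `‖Δu(t)‖₂²` bounded on `t ≥ 1`: `H¹`/`H²` balances, trilinear and `H²` nonlinear estimates, uniform
  Gronwall — stubs S1–S4 of the line) the phase construction is only owed ABOVE the `H²` level (`hFP2`, the skeleton's
  open stub `stub_forwardPhaseH2`); `eternalisationZM_of_forwardPhaseH2`, `chainThesis_of_forwardPhaseH2` and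
  `chainRealisation_of_forwardPhaseH2_of_contrastFamily` are the corresponding sharper conditionals.
* `chainRealisation_of_forwardPhase_of_contrastFamily` — the whole line as ONE conditional theorem: the crux
  `ChainRealisation` follows from `hFP` and the line's residual `ContrastFamily` (a `2½`-dimensional arena force
  `twoHalf g (μ • h)` carrying, along `ν_j → 0`, forward classical mean-zero regular energy-bounded families with
  non-negative mean planar work and a `ν`-uniform axial-contrast floor), through the landed budget step
  `stub_loudOfContrastZM` (its pointwise forward energy bound is automatic by Poincaré, `contrastPackage_of_contrastFamily`).
  Both hypotheses are stated in full (no new definitions); `hFP` is true fixed-`ν` PDE theory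
  not yet in the tree, the residual is the conjecture-grade zeroth-law content of the crux.

References: C. Foias, O. Manley, R. Rosa, R. Temam, *Navier–Stokes Equations and Turbulence* (CUP 2001), Ch. III §2,
Ch. IV §1–3; N. Krylov, N. Bogoliubov (1937); G. D. Birkhoff, PNAS 17 (1931).
-/

set_option linter.dupNamespace false

noncomputable section

open MeasureTheory Set Filter Topology
open scoped InnerProductSpace
open Literature.Analysis.FunctionSpaces Literature.Analysis.FunctionSpaces.Torus
open Literature.Analysis.FluidPDE

namespace Summit.AnomalousDissipation.AnomalousDissipation.Theorems.ChainRealisation.SeparatrixFluxPinning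

open Summit.AnomalousDissipation.AnomalousDissipation.Theorems.DenseLoudDesignerForces.Ergodic
open Literature.Analysis.FluidPDE.Torus
open Summit.AnomalousDissipation.AnomalousDissipation.Theses.MarginalStabilityChain

/-- Local notation: the torus `T³`. -/
local notation "𝕋³" => UnitAddTorus (Fin 3)
/-- Local notation: velocity values. -/
local notation "E³" => EuclideanSpace ℝ (Fin 3)
/-- Local notation: the planar torus `T²`. -/
local notation "𝕋²" => UnitAddTorus (Fin 2)
/-- Local notation: planar velocity values. -/
local notation "E²" => EuclideanSpace ℝ (Fin 2)

/-- `limsup` of a real function along `atTop` equals `longTimeAvgSup g` as soon as it agrees with the Cesàro means of `g`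
at all `T ≥ 0`. -/
theorem limsup_eq_longTimeAvgSup_of_eq_timeMean {a : ℝ → ℝ} {g : ℝ → ℝ}
    (h : ∀ T : ℝ, 0 ≤ T → a T = timeMean g T) : limsup a atTop = longTimeAvgSup g := by
  unfold longTimeAvgSup
  refine limsup_congr ?_
  filter_upwards [eventually_ge_atTop (0 : ℝ)] with T hT using h T hT

/-- **Eternalisation in the mean-zero class, conditional on the forward phase construction.**  If every forward
classical solution on `[0,∞) × T³` (viscosity `ν > 0`, steady smooth solenoidal mean-zero force) with mean-zero slices
and bounded enstrophy lives in an NS phase (`hFP`), then such a solution with limsup-mean energy `≤ E` and limsup-mean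
dissipation `≥ ε > 0` produces an ETERNAL classical solution of the same system with limsup-mean energy
`≤ 16‖f‖₂² max(E,1)²/ε²` and limsup-mean dissipation `≥ ε/2` (Foias–Manley–Rosa–Temam 2001 Ch. IV: time-average
measures, Birkhoff means, budget selection at a generic point). -/
theorem eternalisationZM_of_forwardPhase
    (hFP : ∀ (ν : ℝ) (F : 𝕋³ → E³) (u : ℝ → 𝕋³ → E³) (p : ℝ → 𝕋³ → ℝ),
      0 < ν → IsSmooth F → IsDivFree F → HasZeroMean F →
      IsClassicalNSSolutionOn (Set.Ici 0) ν (fun _ => F) u p →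
      (∃ M : ℝ, ∀ t : ℝ, 0 ≤ t → gradNormSq (u t) ≤ M) →
      (∀ t : ℝ, 0 ≤ t → HasZeroMean (u t)) →
      ∃ (K : Set Hsp) (φ : ℝ → Hsp → Hsp) (x₀ : Hsp), IsNSPhase ν F K φ ∧ x₀ ∈ K ∧
        ∀ t : ℝ, 0 ≤ t → rep (φ t x₀) =ᵐ[volume] u t)
    {ν : ℝ} {f : 𝕋³ → E³} (hν : 0 < ν) (hf : IsSmooth f) (hdiv : IsDivFree f) (hmean : HasZeroMean f)
    (u : ℝ → 𝕋³ → E³) (p : ℝ → 𝕋³ → ℝ) (E ε : ℝ)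
    (hsol : IsClassicalNSSolutionOn (Set.Ici 0) ν (fun _ => f) u p)
    (hM : ∃ M : ℝ, ∀ t : ℝ, 0 ≤ t → gradNormSq (u t) ≤ M)
    (hzm : ∀ t : ℝ, 0 ≤ t → HasZeroMean (u t))
    (hE : meanEnergy u ≤ E) (hε : 0 < ε) (hεD : ε ≤ meanDissipation ν u) :
    ∃ (v : ℝ → 𝕋³ → E³) (q : ℝ → 𝕋³ → ℝ),
      IsClassicalNSSolutionOn Set.univ ν (fun _ => f) v q ∧
      meanEnergy v ≤ 16 * (∫ x, ‖f x‖ ^ 2) * (max E 1) ^ 2 / ε ^ 2 ∧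
      ε / 2 ≤ meanDissipation ν v := by
  -- the forward phase
  obtain ⟨K, φ, x₀, hK, hx₀, hrep⟩ := hFP ν f u p hν hf hdiv hmean hsol hM hzm
  -- its trajectory means are the Cesàro means of the solution
  have hsm : ∀ t : ℝ, 0 ≤ t → IsSmooth (u t) := fun t ht =>
    hsol.smooth_velocity.isSmooth_slice (Set.mem_Ici.2 ht)
  obtain ⟨hEavg, hDavg⟩ := stub_phaseMeans ν f K φ x₀ u hK hx₀ hsm hrep
  have hlimE : limsup (energyAvg φ x₀) atTop = meanEnergy u := by
    rw [meanEnergy_eq_longTimeAvgSup]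
    exact limsup_eq_longTimeAvgSup_of_eq_timeMean hEavg
  have hlimD : limsup (dissipAvg ν φ x₀) atTop = meanDissipation ν u := by
    unfold meanDissipation
    exact limsup_eq_longTimeAvgSup_of_eq_timeMean hDavg
  -- an invariant measure realising the limsup of the dissipation means
  obtain ⟨μ, hμ, hμD, hμE⟩ := stub_invariantMeasureOfTrajectory ν f K φ x₀ hν.le hK hx₀
  have hεμ : ε ≤ ensembleDissipation ν μ := by rw [hμD, hlimD]; exact hεD
  have hEμ : ensembleEnergy μ ≤ E := by rw [hlimE] at hμE; exact hμE.trans hE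
  -- a generic loud point with a complete backward chain
  obtain ⟨y, hyK, hchain, d, e, hd, he, hεd, heE⟩ :=
    stub_genericLoudPoint ν f K φ μ E ε hν hf hmean hK hμ hε hεμ hEμ
  -- the eternal classical solution through it, and its means
  obtain ⟨v, q, hv, hvrep⟩ := stub_eternalOrbit ν f K φ y hν.le hK hyK hchain
  have hsmv : ∀ t : ℝ, 0 ≤ t → IsSmooth (v t) := fun t _ =>
    hv.smooth_velocity.isSmooth_slice (Set.mem_univ t)
  obtain ⟨hEavg', hDavg'⟩ := stub_phaseMeans ν f K φ y v hK hyK hsmv hvrep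
  have hmeanEv : meanEnergy v = e := by
    rw [meanEnergy_eq_longTimeAvgSup, ← limsup_eq_longTimeAvgSup_of_eq_timeMean hEavg']
    exact he.limsup_eq
  have hmeanDv : meanDissipation ν v = d := by
    unfold meanDissipation
    rw [← limsup_eq_longTimeAvgSup_of_eq_timeMean hDavg']
    exact hd.limsup_eq
  exact ⟨v, q, hv, hmeanEv ▸ heE, hmeanDv ▸ hεd⟩

/-- **`ChainThesis` (crux 3005) from a forward-regular loud bounded mean-zero family for ONE force, conditional on the
forward phase construction.** -/
theorem chainThesis_of_forwardPhase
    (hFP : ∀ (ν : ℝ) (F : 𝕋³ → E³) (u : ℝ → 𝕋³ → E³) (p : ℝ → 𝕋³ → ℝ),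
      0 < ν → IsSmooth F → IsDivFree F → HasZeroMean F →
      IsClassicalNSSolutionOn (Set.Ici 0) ν (fun _ => F) u p →
      (∃ M : ℝ, ∀ t : ℝ, 0 ≤ t → gradNormSq (u t) ≤ M) →
      (∀ t : ℝ, 0 ≤ t → HasZeroMean (u t)) →
      ∃ (K : Set Hsp) (φ : ℝ → Hsp → Hsp) (x₀ : Hsp), IsNSPhase ν F K φ ∧ x₀ ∈ K ∧
        ∀ t : ℝ, 0 ≤ t → rep (φ t x₀) =ᵐ[volume] u t)
    {f : 𝕋³ → E³} (hf : IsSmooth f) (hdiv : IsDivFree f) (hmean : HasZeroMean f)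
    (hC : ∃ (ν : ℕ → ℝ) (u : ℕ → ℝ → 𝕋³ → E³) (p : ℕ → ℝ → 𝕋³ → ℝ),
      (∀ j, 0 < ν j) ∧ Tendsto ν atTop (nhds 0) ∧
      (∀ j, IsClassicalNSSolutionOn (Set.Ici 0) (ν j) (fun _ => f) (u j) (p j)) ∧
      (∀ j, ∃ M : ℝ, ∀ t : ℝ, 0 ≤ t → gradNormSq (u j t) ≤ M) ∧
      (∀ j t, 0 ≤ t → HasZeroMean (u j t)) ∧
      (∃ E : ℝ, ∀ j, meanEnergy (u j) ≤ E) ∧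
      ∃ ε : ℝ, 0 < ε ∧ ∀ j, ε ≤ meanDissipation (ν j) (u j)) :
    ChainThesis := by
  obtain ⟨ν, u, p, hν, hν0, hsol, hM, hzm, ⟨E, hE⟩, ε, hε, hεle⟩ := hC
  have key : ∀ j, ∃ (v : ℝ → 𝕋³ → E³) (q : ℝ → 𝕋³ → ℝ),
      IsClassicalNSSolutionOn Set.univ (ν j) (fun _ => f) v q ∧
      meanEnergy v ≤ 16 * (∫ x, ‖f x‖ ^ 2) * (max E 1) ^ 2 / ε ^ 2 ∧
      ε / 2 ≤ meanDissipation (ν j) v :=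
    fun j => eternalisationZM_of_forwardPhase hFP (hν j) hf hdiv hmean (u j) (p j) E ε (hsol j) (hM j)
      (hzm j) (hE j) hε (hεle j)
  choose v q hv using key
  exact ⟨f, hf, hdiv, hmean, ν, v, q, hν, hν0, fun j => (hv j).1, ⟨_, fun j => (hv j).2.1⟩, ε / 2,
    by positivity, fun j => (hv j).2.2⟩

/-- **The residual supplies the hypothesis package of the budget step**: the pointwise forward energy bound asked by
`stub_loudOfContrastZM` is automatic for mean-zero slices with bounded enstrophy (Poincaré `4π²∫‖u‖² ≤ ‖∇u‖₂²`,
`four_pi_sq_mul_integral_norm_sq_le_gradNormSq`). -/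
theorem contrastPackage_of_contrastFamily
    (hCF : ∃ (g : 𝕋² → E²) (h : 𝕋² → ℝ) (μ a₀ E : ℝ),
      IsSmooth g ∧ IsDivFree g ∧ HasZeroMean g ∧ IsSmooth h ∧ HasZeroMean h ∧ 0 < μ ∧ 0 < a₀ ∧
      ∃ (ν : ℕ → ℝ) (u : ℕ → ℝ → 𝕋³ → E³) (p : ℕ → ℝ → 𝕋³ → ℝ),
        (∀ j, 0 < ν j) ∧ Tendsto ν atTop (nhds 0) ∧
        (∀ j, IsClassicalNSSolutionOn (Set.Ici 0) (ν j) (fun _ => twoHalf g (μ • h)) (u j) (p j)) ∧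
        (∀ j, ∃ M : ℝ, ∀ t : ℝ, 0 ≤ t → gradNormSq (u j t) ≤ M) ∧
        (∀ j t, 0 ≤ t → HasZeroMean (u j t)) ∧
        (∀ j, meanEnergy (u j) ≤ E) ∧
        (∀ j, 0 ≤ longTimeAvgInf (fun t => ∫ x, ⟪g (planarProj x), planarProjE (u j t x)⟫_ℝ)) ∧
        (∀ j, a₀ ≤ longTimeAvgSup (fun t => ∫ x, h (planarProj x) * u j t x 2))) :
    ∃ (g : 𝕋² → E²) (h : 𝕋² → ℝ) (μ a₀ E : ℝ),
      IsSmooth g ∧ IsDivFree g ∧ HasZeroMean g ∧ IsSmooth h ∧ HasZeroMean h ∧ 0 < μ ∧ 0 < a₀ ∧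
      ∃ (ν : ℕ → ℝ) (u : ℕ → ℝ → 𝕋³ → E³) (p : ℕ → ℝ → 𝕋³ → ℝ),
        (∀ j, 0 < ν j) ∧ Tendsto ν atTop (nhds 0) ∧
        (∀ j, IsClassicalNSSolutionOn (Set.Ici 0) (ν j) (fun _ => twoHalf g (μ • h)) (u j) (p j)) ∧
        (∀ j, ∃ M : ℝ, ∀ t : ℝ, 0 ≤ t → gradNormSq (u j t) ≤ M) ∧
        (∀ j t, 0 ≤ t → HasZeroMean (u j t)) ∧
        (∀ j, ∃ C : ℝ, ∀ t : ℝ, 0 ≤ t → ∫ x, ‖u j t x‖ ^ 2 ≤ C) ∧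
        (∀ j, meanEnergy (u j) ≤ E) ∧
        (∀ j, 0 ≤ longTimeAvgInf (fun t => ∫ x, ⟪g (planarProj x), planarProjE (u j t x)⟫_ℝ)) ∧
        (∀ j, a₀ ≤ longTimeAvgSup (fun t => ∫ x, h (planarProj x) * u j t x 2)) := by
  obtain ⟨g, h, μ, a₀, E, hg, hgdiv, hg0, hh, hh0, hμ, ha₀, ν, u, p, hν, hν0, hsol, hM, hzm, hE, hIg, hIh⟩ := hCF
  refine ⟨g, h, μ, a₀, E, hg, hgdiv, hg0, hh, hh0, hμ, ha₀, ν, u, p, hν, hν0, hsol, hM, hzm, ?_, hE, hIg, hIh⟩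
  intro j
  obtain ⟨M, hMj⟩ := hM j
  refine ⟨M / (4 * Real.pi ^ 2), fun t ht => ?_⟩
  have hsm : IsSmooth (u j t) := (hsol j).smooth_velocity.isSmooth_slice (Set.mem_Ici.2 ht)
  have hP := four_pi_sq_mul_integral_norm_sq_le_gradNormSq hsm (hzm j t ht)
  have hπ : 0 < 4 * Real.pi ^ 2 := by positivity
  rw [le_div_iff₀ hπ]
  calc (∫ x, ‖u j t x‖ ^ 2) * (4 * Real.pi ^ 2) = 4 * Real.pi ^ 2 * ∫ x, ‖u j t x‖ ^ 2 := by ring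
    _ ≤ gradNormSq (u j t) := hP
    _ ≤ M := hMj t ht

/-- **The line as one conditional theorem: `ChainRealisation` from the forward phase construction and the line's
residual (the contrast family).**  The unit-cell antecedents of the crux are not used (every proof of the crux factors
through `ChainThesis`); the residual's contrast floor becomes a dissipation floor by the landed budget step
`stub_loudOfContrastZM`, and the forward loud family is eternalised by `chainThesis_of_forwardPhase`. -/
theorem chainRealisation_of_forwardPhase_of_contrastFamily
    (hFP : ∀ (ν : ℝ) (F : 𝕋³ → E³) (u : ℝ → 𝕋³ → E³) (p : ℝ → 𝕋³ → ℝ),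
      0 < ν → IsSmooth F → IsDivFree F → HasZeroMean F →
      IsClassicalNSSolutionOn (Set.Ici 0) ν (fun _ => F) u p →
      (∃ M : ℝ, ∀ t : ℝ, 0 ≤ t → gradNormSq (u t) ≤ M) →
      (∀ t : ℝ, 0 ≤ t → HasZeroMean (u t)) →
      ∃ (K : Set Hsp) (φ : ℝ → Hsp → Hsp) (x₀ : Hsp), IsNSPhase ν F K φ ∧ x₀ ∈ K ∧
        ∀ t : ℝ, 0 ≤ t → rep (φ t x₀) =ᵐ[volume] u t)
    (hCF : ∃ (g : 𝕋² → E²) (h : 𝕋² → ℝ) (μ a₀ E : ℝ),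
      IsSmooth g ∧ IsDivFree g ∧ HasZeroMean g ∧ IsSmooth h ∧ HasZeroMean h ∧ 0 < μ ∧ 0 < a₀ ∧
      ∃ (ν : ℕ → ℝ) (u : ℕ → ℝ → 𝕋³ → E³) (p : ℕ → ℝ → 𝕋³ → ℝ),
        (∀ j, 0 < ν j) ∧ Tendsto ν atTop (nhds 0) ∧
        (∀ j, IsClassicalNSSolutionOn (Set.Ici 0) (ν j) (fun _ => twoHalf g (μ • h)) (u j) (p j)) ∧
        (∀ j, ∃ M : ℝ, ∀ t : ℝ, 0 ≤ t → gradNormSq (u j t) ≤ M) ∧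
        (∀ j t, 0 ≤ t → HasZeroMean (u j t)) ∧
        (∀ j, meanEnergy (u j) ≤ E) ∧
        (∀ j, 0 ≤ longTimeAvgInf (fun t => ∫ x, ⟪g (planarProj x), planarProjE (u j t x)⟫_ℝ)) ∧
        (∀ j, a₀ ≤ longTimeAvgSup (fun t => ∫ x, h (planarProj x) * u j t x 2))) :
    ChainRealisation := by
  intro _ _ _
  obtain ⟨f, hf, hdiv, hmean, hC⟩ := stub_loudOfContrastZM (contrastPackage_of_contrastFamily hCF)
  exact chainThesis_of_forwardPhase hFP hf hdiv hmean hC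

/-! ## The `H²` rung discharged: conditionals above the `H²` level -/

/-- **Forward phase from the phase construction above the `H²` rung.**  The landed absorbing bound
`stub_laplacianSupBound` supplies the hypothesis `‖Δu(t)‖₂² ≤ M₂` (`t ≥ 1`) of `hFP2`. -/
theorem forwardPhase_of_forwardPhaseH2
    (hFP2 : ∀ (ν : ℝ) (F : 𝕋³ → E³) (u : ℝ → 𝕋³ → E³) (p : ℝ → 𝕋³ → ℝ),
      0 < ν → IsSmooth F → IsDivFree F → HasZeroMean F →
      IsClassicalNSSolutionOn (Set.Ici 0) ν (fun _ => F) u p →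
      (∃ M : ℝ, ∀ t : ℝ, 0 ≤ t → gradNormSq (u t) ≤ M) →
      (∀ t : ℝ, 0 ≤ t → HasZeroMean (u t)) →
      (∃ M₂ : ℝ, ∀ t : ℝ, 1 ≤ t → ∫ x, ‖laplacian (u t) x‖ ^ 2 ≤ M₂) →
      ∃ (K : Set Hsp) (φ : ℝ → Hsp → Hsp) (x₀ : Hsp), IsNSPhase ν F K φ ∧ x₀ ∈ K ∧
        ∀ t : ℝ, 0 ≤ t → rep (φ t x₀) =ᵐ[volume] u t) :
    ∀ (ν : ℝ) (F : 𝕋³ → E³) (u : ℝ → 𝕋³ → E³) (p : ℝ → 𝕋³ → ℝ),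
      0 < ν → IsSmooth F → IsDivFree F → HasZeroMean F →
      IsClassicalNSSolutionOn (Set.Ici 0) ν (fun _ => F) u p →
      (∃ M : ℝ, ∀ t : ℝ, 0 ≤ t → gradNormSq (u t) ≤ M) →
      (∀ t : ℝ, 0 ≤ t → HasZeroMean (u t)) →
      ∃ (K : Set Hsp) (φ : ℝ → Hsp → Hsp) (x₀ : Hsp), IsNSPhase ν F K φ ∧ x₀ ∈ K ∧
        ∀ t : ℝ, 0 ≤ t → rep (φ t x₀) =ᵐ[volume] u t := by
  intro ν F u p hν hF hdiv hmean hsol hM hzm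
  refine hFP2 ν F u p hν hF hdiv hmean hsol hM hzm ?_
  obtain ⟨M, hM'⟩ := hM
  exact stub_laplacianSupBound ν M F u p hν hF hsol hM' hzm

/-- **Eternalisation in the mean-zero class, conditional only on the phase construction above the `H²` rung.** -/
theorem eternalisationZM_of_forwardPhaseH2
    (hFP2 : ∀ (ν : ℝ) (F : 𝕋³ → E³) (u : ℝ → 𝕋³ → E³) (p : ℝ → 𝕋³ → ℝ),
      0 < ν → IsSmooth F → IsDivFree F → HasZeroMean F →
      IsClassicalNSSolutionOn (Set.Ici 0) ν (fun _ => F) u p →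
      (∃ M : ℝ, ∀ t : ℝ, 0 ≤ t → gradNormSq (u t) ≤ M) →
      (∀ t : ℝ, 0 ≤ t → HasZeroMean (u t)) →
      (∃ M₂ : ℝ, ∀ t : ℝ, 1 ≤ t → ∫ x, ‖laplacian (u t) x‖ ^ 2 ≤ M₂) →
      ∃ (K : Set Hsp) (φ : ℝ → Hsp → Hsp) (x₀ : Hsp), IsNSPhase ν F K φ ∧ x₀ ∈ K ∧
        ∀ t : ℝ, 0 ≤ t → rep (φ t x₀) =ᵐ[volume] u t)
    {ν : ℝ} {f : 𝕋³ → E³} (hν : 0 < ν) (hf : IsSmooth f) (hdiv : IsDivFree f) (hmean : HasZeroMean f)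
    (u : ℝ → 𝕋³ → E³) (p : ℝ → 𝕋³ → ℝ) (E ε : ℝ)
    (hsol : IsClassicalNSSolutionOn (Set.Ici 0) ν (fun _ => f) u p)
    (hM : ∃ M : ℝ, ∀ t : ℝ, 0 ≤ t → gradNormSq (u t) ≤ M)
    (hzm : ∀ t : ℝ, 0 ≤ t → HasZeroMean (u t))
    (hE : meanEnergy u ≤ E) (hε : 0 < ε) (hεD : ε ≤ meanDissipation ν u) :
    ∃ (v : ℝ → 𝕋³ → E³) (q : ℝ → 𝕋³ → ℝ),
      IsClassicalNSSolutionOn Set.univ ν (fun _ => f) v q ∧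
      meanEnergy v ≤ 16 * (∫ x, ‖f x‖ ^ 2) * (max E 1) ^ 2 / ε ^ 2 ∧
      ε / 2 ≤ meanDissipation ν v :=
  eternalisationZM_of_forwardPhase (forwardPhase_of_forwardPhaseH2 hFP2) hν hf hdiv hmean u p E ε hsol hM hzm hE hε hεD

/-- **`ChainThesis` (crux 3005) from a forward-regular loud bounded mean-zero family for ONE force, conditional only on
the phase construction above the `H²` rung.** -/
theorem chainThesis_of_forwardPhaseH2
    (hFP2 : ∀ (ν : ℝ) (F : 𝕋³ → E³) (u : ℝ → 𝕋³ → E³) (p : ℝ → 𝕋³ → ℝ),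
      0 < ν → IsSmooth F → IsDivFree F → HasZeroMean F →
      IsClassicalNSSolutionOn (Set.Ici 0) ν (fun _ => F) u p →
      (∃ M : ℝ, ∀ t : ℝ, 0 ≤ t → gradNormSq (u t) ≤ M) →
      (∀ t : ℝ, 0 ≤ t → HasZeroMean (u t)) →
      (∃ M₂ : ℝ, ∀ t : ℝ, 1 ≤ t → ∫ x, ‖laplacian (u t) x‖ ^ 2 ≤ M₂) →
      ∃ (K : Set Hsp) (φ : ℝ → Hsp → Hsp) (x₀ : Hsp), IsNSPhase ν F K φ ∧ x₀ ∈ K ∧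
        ∀ t : ℝ, 0 ≤ t → rep (φ t x₀) =ᵐ[volume] u t)
    {f : 𝕋³ → E³} (hf : IsSmooth f) (hdiv : IsDivFree f) (hmean : HasZeroMean f)
    (hC : ∃ (ν : ℕ → ℝ) (u : ℕ → ℝ → 𝕋³ → E³) (p : ℕ → ℝ → 𝕋³ → ℝ),
      (∀ j, 0 < ν j) ∧ Tendsto ν atTop (nhds 0) ∧
      (∀ j, IsClassicalNSSolutionOn (Set.Ici 0) (ν j) (fun _ => f) (u j) (p j)) ∧
      (∀ j, ∃ M : ℝ, ∀ t : ℝ, 0 ≤ t → gradNormSq (u j t) ≤ M) ∧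
      (∀ j t, 0 ≤ t → HasZeroMean (u j t)) ∧
      (∃ E : ℝ, ∀ j, meanEnergy (u j) ≤ E) ∧
      ∃ ε : ℝ, 0 < ε ∧ ∀ j, ε ≤ meanDissipation (ν j) (u j)) :
    ChainThesis :=
  chainThesis_of_forwardPhase (forwardPhase_of_forwardPhaseH2 hFP2) hf hdiv hmean hC

/-- **The line as one conditional theorem, above the `H²` rung: `ChainRealisation` from the phase construction for
`H²`-bounded forward classical solutions and the line's residual (the contrast family).** -/
theorem chainRealisation_of_forwardPhaseH2_of_contrastFamily
    (hFP2 : ∀ (ν : ℝ) (F : 𝕋³ → E³) (u : ℝ → 𝕋³ → E³) (p : ℝ → 𝕋³ → ℝ),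
      0 < ν → IsSmooth F → IsDivFree F → HasZeroMean F →
      IsClassicalNSSolutionOn (Set.Ici 0) ν (fun _ => F) u p →
      (∃ M : ℝ, ∀ t : ℝ, 0 ≤ t → gradNormSq (u t) ≤ M) →
      (∀ t : ℝ, 0 ≤ t → HasZeroMean (u t)) →
      (∃ M₂ : ℝ, ∀ t : ℝ, 1 ≤ t → ∫ x, ‖laplacian (u t) x‖ ^ 2 ≤ M₂) →
      ∃ (K : Set Hsp) (φ : ℝ → Hsp → Hsp) (x₀ : Hsp), IsNSPhase ν F K φ ∧ x₀ ∈ K ∧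
        ∀ t : ℝ, 0 ≤ t → rep (φ t x₀) =ᵐ[volume] u t)
    (hCF : ∃ (g : 𝕋² → E²) (h : 𝕋² → ℝ) (μ a₀ E : ℝ),
      IsSmooth g ∧ IsDivFree g ∧ HasZeroMean g ∧ IsSmooth h ∧ HasZeroMean h ∧ 0 < μ ∧ 0 < a₀ ∧
      ∃ (ν : ℕ → ℝ) (u : ℕ → ℝ → 𝕋³ → E³) (p : ℕ → ℝ → 𝕋³ → ℝ),
        (∀ j, 0 < ν j) ∧ Tendsto ν atTop (nhds 0) ∧
        (∀ j, IsClassicalNSSolutionOn (Set.Ici 0) (ν j) (fun _ => twoHalf g (μ • h)) (u j) (p j)) ∧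
        (∀ j, ∃ M : ℝ, ∀ t : ℝ, 0 ≤ t → gradNormSq (u j t) ≤ M) ∧
        (∀ j t, 0 ≤ t → HasZeroMean (u j t)) ∧
        (∀ j, meanEnergy (u j) ≤ E) ∧
        (∀ j, 0 ≤ longTimeAvgInf (fun t => ∫ x, ⟪g (planarProj x), planarProjE (u j t x)⟫_ℝ)) ∧
        (∀ j, a₀ ≤ longTimeAvgSup (fun t => ∫ x, h (planarProj x) * u j t x 2))) :
    ChainRealisation :=
  chainRealisation_of_forwardPhase_of_contrastFamily (forwardPhase_of_forwardPhaseH2 hFP2) hCF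

/-- **The line as ONE conditional theorem** (the skeleton's registered glue stub `stub_lineConditional`, stated in the
`→` form): `ChainThesis` — hence the crux, `chainRealisation_of_forwardPhaseH2_of_contrastFamily` — from the phase construction for `H²`-bounded forward classical solutions and the residual
contrast family. -/
theorem stub_lineConditional :
    (∀ (ν : ℝ) (F : 𝕋³ → E³) (u : ℝ → 𝕋³ → E³) (p : ℝ → 𝕋³ → ℝ),
      0 < ν → IsSmooth F → IsDivFree F → HasZeroMean F →
      IsClassicalNSSolutionOn (Set.Ici 0) ν (fun _ => F) u p →
      (∃ M : ℝ, ∀ t : ℝ, 0 ≤ t → gradNormSq (u t) ≤ M) →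
      (∀ t : ℝ, 0 ≤ t → HasZeroMean (u t)) →
      (∃ M₂ : ℝ, ∀ t : ℝ, 1 ≤ t → ∫ x, ‖laplacian (u t) x‖ ^ 2 ≤ M₂) →
      ∃ (K : Set Hsp) (φ : ℝ → Hsp → Hsp) (x₀ : Hsp), IsNSPhase ν F K φ ∧ x₀ ∈ K ∧
        ∀ t : ℝ, 0 ≤ t → rep (φ t x₀) =ᵐ[volume] u t) →
    (∃ (g : 𝕋² → E²) (h : 𝕋² → ℝ) (μ a₀ E : ℝ),
      IsSmooth g ∧ IsDivFree g ∧ HasZeroMean g ∧ IsSmooth h ∧ HasZeroMean h ∧ 0 < μ ∧ 0 < a₀ ∧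
      ∃ (ν : ℕ → ℝ) (u : ℕ → ℝ → 𝕋³ → E³) (p : ℕ → ℝ → 𝕋³ → ℝ),
        (∀ j, 0 < ν j) ∧ Tendsto ν atTop (nhds 0) ∧
        (∀ j, IsClassicalNSSolutionOn (Set.Ici 0) (ν j) (fun _ => twoHalf g (μ • h)) (u j) (p j)) ∧
        (∀ j, ∃ M : ℝ, ∀ t : ℝ, 0 ≤ t → gradNormSq (u j t) ≤ M) ∧
        (∀ j t, 0 ≤ t → HasZeroMean (u j t)) ∧
        (∀ j, meanEnergy (u j) ≤ E) ∧
        (∀ j, 0 ≤ longTimeAvgInf (fun t => ∫ x, ⟪g (planarProj x), planarProjE (u j t x)⟫_ℝ)) ∧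
        (∀ j, a₀ ≤ longTimeAvgSup (fun t => ∫ x, h (planarProj x) * u j t x 2))) →
    ChainThesis :=
  fun hFP2 hCF =>
    let ⟨_, hf, hdiv, hmean, hC⟩ := stub_loudOfContrastZM (contrastPackage_of_contrastFamily hCF)
    chainThesis_of_forwardPhaseH2 hFP2 hf hdiv hmean hC

end Summit.AnomalousDissipation.AnomalousDissipation.Theorems.ChainRealisation.SeparatrixFluxPinning

end
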